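import Summits.QuantumAdvantage.QuantumAdvantage.Theorems.WalkNoPerfectLinSelCore
import HarnessLib

/-!
# R5₀ proved: `Coset21.NoPerfectLinSel p` for every prime `p ≥ 5`, with a subcube loss bound — part 2 of 2
(planner qa-qnc0-p2 g23, ROUND-23 §1; the char-2 machinery is in `WalkNoPerfectLinSelCore.lean`)

**Theorem A** (`noPerfectLinSel`, item `OddPrimeWalk.NoPerfectLinSelOdd`). For every prime `p ≥ 5` there is `n₀` such that for
all `n ≥ n₀`, every charge `c` and every linear-test (`LinSel p`) strategy `y`, some input `u ∈ {0,1}ⁿ` LOSES the u-walk game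
(`ringWinU c y u = false`).  (Kit data K-26: perfect `LinSel 5` strategies EXIST for `n ≤ 8`; the proof gives `n₀(5) ≤ 62`.)

**Theorem B** (`linSel_loss_ge`, item `OddPrimeWalk.LinSelSubcubeLossOdd`, the quantitative form). If `m ≤ n` and
`(n+1)·2p·(2p−1)^m < (2p)^m` (true once `m ≥ 2p·ln(2p(n+1))`, i.e. `m = O(p log(pn))`), then every `LinSel p` strategy loses on at
least `2^{n−m}` inputs: an INVERSE-POLYNOMIAL loss `2ⁿ·(2p(n+1))^{−O(p)}` for ARBITRARY (in particular dense) linear tests.  This is NOT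
`θ < 1` (crux R5 `WalkHardFLinSel`); it is the ceiling of the method (a loss set meeting every `m`-subcube can have density `≈ 2^{−m}`).

Contents: §7 the abstract no-perfect theorem (`abstract_even_exists`) · §8 the numerical threshold · §9 the walk game as an instance
(Theorem A over an abstract field) · §10 Theorem B via subcubes · §11 instantiation in `CyclotomicField (3p) (ZMod 2)` and the item forms.
-/

open Finset

namespace Summit.QuantumAdvantage.AdviceFreeQNC0

namespace Coset21

namespace CharTwoKill

section Killing

variable {p : ℕ} [Fact p.Prime] {K : Type*} [Field K] [CharP K 2]
variable {G : Type*} [Fintype G] {m : ℕ}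
variable (ω ζ : K) (hω : IsPrimitiveRoot ω p)
variable (ℓ : G → Fin m → ZMod p) (r : G → ZMod p) (κ : G → ℕ) (w : G → Fin m → ℕ)

/-! ### §7 The abstract theorem: no strategy fires an odd number of cuts at every input -/

include ω hω in
/-- **Abstract no-perfect theorem.** If `#G·2p·(2p−1)^m < (2p)^m` then some `u ∈ {0,1}^m` fires an EVEN number of cuts
(any characteristic-two field with a primitive `p`-th root `ω` and a primitive cube root `ζ` serves as the coefficient field). -/
theorem abstract_even_exists [DecidableEq G] (hp5 : 5 ≤ p) (hζ : IsPrimitiveRoot ζ 3)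
    (hw : ∀ g i, w g i = 1 ∨ w g i = 2)
    (hcount : Fintype.card G * (2 * p) * (2 * p - 1) ^ m < (2 * p) ^ m) :
    ∃ u : Fin m → Bool, (univ.filter fun g : G => linForm ℓ g u = r g ∧ (κ g + wForm w g u) % 3 ≠ 0).card % 2 = 0 := by
  classical
  by_contra hall
  push Not at hall
  -- the fire count is identically 1 in K
  have hW : ∀ u, Wsum ω ζ hω ℓ r κ w u = 1 := by
    intro u
    rw [← card_fire_eq_Wsum ω ζ hω ℓ r κ w hp5 hζ u]
    have hodd : (univ.filter fun g : G => linForm ℓ g u = r g ∧ (κ g + wForm w g u) % 3 ≠ 0).card % 2 = 1 := by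
      have := hall u; omega
    rw [CharP.cast_eq_mod K 2, hodd, Nat.cast_one]
  -- a hitting colouring exists
  set V : Finset (ZMod p × ℕ) := (univ : Finset (ZMod p)) ×ˢ ({1, 2} : Finset ℕ) with hVdef
  have hV : ∀ t i, colour ℓ w t i ∈ V := colour_mem ℓ w hw
  have hVcard : V.card = 2 * p := by
    rw [hVdef, card_product, card_univ, ZMod.card]
    simp
    ring
  have hcount' : Fintype.card (Term p G) * (V.card - 1) ^ m < V.card ^ m := by
    rw [hVcard, card_Term]
    exact hcount
  obtain ⟨γ', hγV, hhit⟩ := hits_exists ℓ w V hV hcount'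
  have hγ2 : ∀ i, (γ' i).2 % 3 ≠ 0 := by
    intro i
    have := hγV i
    rw [hVdef, mem_product] at this
    rcases this with ⟨-, h2⟩
    simp only [mem_insert, mem_singleton] at h2
    rcases h2 with h2 | h2 <;> omega
  -- evaluate Φ two ways
  have hzero := Phi_Wsum_eq_zero ω ζ hω ℓ r κ w hζ γ' hhit
  have hfun : Wsum ω ζ hω ℓ r κ w = fun _ => (1 : K) := funext hW
  rw [hfun, Phi_one] at hzero
  exact (prod_ne_zero_iff.mpr fun i _ => one_add_gam_ne_zero ω ζ hω hp5 hζ (γ' i) (hγ2 i)) hzero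

end Killing

/-! ### §8 The numerical threshold: `(n+1)·q·(q−1)ⁿ < qⁿ` eventually -/

/-- the numerical threshold: `(n+1)·q·(q−1)ⁿ < qⁿ` for all large `n` (`q ≥ 2`) -/
theorem count_eventually (q : ℕ) (hq : 2 ≤ q) :
    ∃ n₀, ∀ n ≥ n₀, (n + 1) * q * (q - 1) ^ n < q ^ n := by
  have hq0 : (0 : ℝ) < q := by exact_mod_cast (by omega : 0 < q)
  have hq2 : (2 : ℝ) ≤ q := by exact_mod_cast hq
  set ρ : ℝ := ((q : ℝ) - 1) / q with hρ
  have hρ0 : 0 ≤ ρ := div_nonneg (by linarith) hq0.le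
  have hρ1 : ρ < 1 := by rw [div_lt_one hq0]; linarith
  have ht := tendsto_self_mul_const_pow_of_lt_one hρ0 hρ1
  have hε : (0 : ℝ) < 1 / (4 * q) := by positivity
  obtain ⟨N, hN⟩ := Filter.eventually_atTop.mp (ht.eventually (gt_mem_nhds hε))
  refine ⟨max N 1, fun n hn => ?_⟩
  have hnN : N ≤ n := le_trans (le_max_left _ _) hn
  have hn1 : 1 ≤ n := le_trans (le_max_right _ _) hn
  have h1 : (n : ℝ) * ρ ^ n < 1 / (4 * q) := hN n hnN
  have hqn : (0 : ℝ) < (q : ℝ) ^ n := pow_pos hq0 n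
  have hn1' : (1 : ℝ) ≤ n := by exact_mod_cast hn1
  have hsmall : ((n : ℝ) + 1) * q * ρ ^ n < 1 := by
    have hρn0 : (0 : ℝ) ≤ q * ρ ^ n := by positivity
    calc ((n : ℝ) + 1) * q * ρ ^ n ≤ 2 * n * q * ρ ^ n := by nlinarith
      _ = 2 * q * (n * ρ ^ n) := by ring
      _ ≤ 2 * q * (1 / (4 * q)) := by apply mul_le_mul_of_nonneg_left h1.le; positivity
      _ = 1 / 2 := by field_simp; ring
      _ < 1 := by norm_num
  have key : ((n : ℝ) + 1) * q * ((q : ℝ) - 1) ^ n < (q : ℝ) ^ n := by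
    have hρn : ((q : ℝ) - 1) ^ n = ρ ^ n * (q : ℝ) ^ n := by
      rw [hρ, div_pow, div_mul_cancel₀ _ hqn.ne']
    rw [hρn]
    calc ((n : ℝ) + 1) * q * (ρ ^ n * (q : ℝ) ^ n) = (((n : ℝ) + 1) * q * ρ ^ n) * (q : ℝ) ^ n := by ring
      _ < 1 * (q : ℝ) ^ n := mul_lt_mul_of_pos_right hsmall hqn
      _ = (q : ℝ) ^ n := one_mul _
  have hcast : (((n + 1) * q * (q - 1) ^ n : ℕ) : ℝ) = ((n : ℝ) + 1) * q * ((q : ℝ) - 1) ^ n := by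
    push_cast [Nat.cast_sub (by omega : 1 ≤ q)]
    ring
  have : (((n + 1) * q * (q - 1) ^ n : ℕ) : ℝ) < ((q ^ n : ℕ) : ℝ) := by
    rw [hcast]; push_cast; exact key
  exact_mod_cast this

/-! ### §9 The walk game is an instance: Theorem A over an abstract field -/

section WalkInstance

variable {p : ℕ} [Fact p.Prime] {K : Type*} [Field K] [CharP K 2]

/-- the fire set of the walk game at `u` is the abstract fire set with `κ_g = c + g`, `w = ww`. -/
theorem walk_filter_eq {n : ℕ} (c : ℕ) (y : Fin (n + 1) → (Fin n → Bool) → Bool)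
    (ℓ : Fin (n + 1) → Fin n → ZMod p) (r : Fin (n + 1) → ZMod p)
    (hy : ∀ g u, y g u = decide ((∑ i, if u i = true then ℓ g i else 0) = r g)) (u : Fin n → Bool) :
    (univ.filter fun g : Fin (n + 1) => y g u = true ∧ (c + g.val + walkExp u g.val) % 3 ≠ 0)
      = (univ.filter fun g : Fin (n + 1) =>
          linForm ℓ g u = r g ∧ ((c + g.val) + wForm (fun g' i => ww g'.val i) g u) % 3 ≠ 0) := by
  refine filter_congr fun g _ => ?_
  rw [hy g u, decide_eq_true_eq, walkExp_eq_sum]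
  unfold linForm wForm
  simp only [add_assoc]

/-- **Theorem A over any field of characteristic two with the two roots of unity.** -/
theorem noPerfectLinSel_of_roots (ω ζ : K) (hω : IsPrimitiveRoot ω p) (hζ : IsPrimitiveRoot ζ 3) (hp5 : 5 ≤ p) :
    NoPerfectLinSel p := by
  classical
  obtain ⟨n₀, hn₀⟩ := count_eventually (2 * p) (by omega)
  refine ⟨n₀, fun n hn c y hy => ?_⟩
  choose ℓ r hℓr using hy
  have hcount : Fintype.card (Fin (n + 1)) * (2 * p) * (2 * p - 1) ^ n < (2 * p) ^ n := by
    rw [Fintype.card_fin]; exact hn₀ n hn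
  obtain ⟨u, hu⟩ := abstract_even_exists ω ζ hω ℓ r (fun g : Fin (n + 1) => c + g.val)
    (fun (g : Fin (n + 1)) (i : Fin n) => ww g.val i) hp5 hζ (fun g i => ww_mem g.val i) hcount
  refine ⟨u, ?_⟩
  rw [Bool.eq_false_iff]
  intro hwin
  simp only [ringWinU, decide_eq_true_eq] at hwin
  rw [walk_filter_eq c y ℓ r hℓr u] at hwin
  omega

end WalkInstance

/-! ### §10 Theorem B: one loser in every subcube `{u : u|_{[m, m+k)} = v}` -/

section Subcube

variable {p : ℕ} [Fact p.Prime] {K : Type*} [Field K] [CharP K 2]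

/-- restricted data: for the subcube with the LAST `k` coordinates frozen to `v`, cut `g` has form `ℓ g ∘ castAdd`,
residue `r g − Σ_j v_j ℓ_{g, m+j}`, constant `c + g + Σ_j v_j w_{g,m+j}` and weights `ww g ∘ castAdd`. -/
theorem subcube_filter_eq {m k : ℕ} (c : ℕ) (y : Fin (m + k + 1) → (Fin (m + k) → Bool) → Bool)
    (ℓ : Fin (m + k + 1) → Fin (m + k) → ZMod p) (r : Fin (m + k + 1) → ZMod p)
    (hy : ∀ g u, y g u = decide ((∑ i, if u i = true then ℓ g i else 0) = r g))
    (v : Fin k → Bool) (u' : Fin m → Bool) :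
    (univ.filter fun g : Fin (m + k + 1) =>
        y g (Fin.append u' v) = true ∧ (c + g.val + walkExp (Fin.append u' v) g.val) % 3 ≠ 0)
      = (univ.filter fun g : Fin (m + k + 1) =>
          linForm (fun g' i => ℓ g' (Fin.castAdd k i)) g u'
              = r g - (∑ j, if v j = true then ℓ g (Fin.natAdd m j) else 0) ∧
            ((c + g.val + ∑ j, if v j = true then ww g.val (Fin.natAdd m j) else 0)
              + wForm (fun g' i => ww g'.val (Fin.castAdd k i)) g u') % 3 ≠ 0) := by
  refine filter_congr fun g _ => ?_
  rw [hy g _, decide_eq_true_eq, walkExp_eq_sum, Fin.sum_univ_add, Fin.sum_univ_add]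
  unfold linForm wForm
  simp only [Fin.append_left, Fin.append_right]
  constructor
  · rintro ⟨h1, h2⟩
    refine ⟨by rw [← h1]; ring, ?_⟩
    intro h; apply h2; omega
  · rintro ⟨h1, h2⟩
    refine ⟨by rw [h1]; ring, ?_⟩
    intro h; apply h2; omega

/-- **Theorem B (counting form).**  If `(m+k+1)·2p·(2p−1)^m < (2p)^m` then every `LinSel p` strategy on `n = m + k` bits loses on
at least `2^k` inputs (one in each subcube with the last `k` coordinates frozen). -/
theorem linSel_loss_lower_bound_add (ω ζ : K) (hω : IsPrimitiveRoot ω p) (hζ : IsPrimitiveRoot ζ 3)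
    (hp5 : 5 ≤ p) (m k : ℕ)
    (hcount : (m + k + 1) * (2 * p) * (2 * p - 1) ^ m < (2 * p) ^ m) (c : ℕ)
    (y : Fin (m + k + 1) → (Fin (m + k) → Bool) → Bool) (hy : LinSel p y) :
    2 ^ k ≤ (univ.filter fun u : Fin (m + k) → Bool => ringWinU c y u = false).card := by
  classical
  choose ℓ r hℓr using hy
  -- one loser per frozen assignment v
  have hloser : ∀ v : Fin k → Bool, ∃ u' : Fin m → Bool, ringWinU c y (Fin.append u' v) = false := by
    intro v
    have hcount' : Fintype.card (Fin (m + k + 1)) * (2 * p) * (2 * p - 1) ^ m < (2 * p) ^ m := by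
      rw [Fintype.card_fin]; exact hcount
    obtain ⟨u', hu'⟩ := abstract_even_exists ω ζ hω
      (fun (g : Fin (m + k + 1)) (i : Fin m) => ℓ g (Fin.castAdd k i))
      (fun g : Fin (m + k + 1) => r g - (∑ j, if v j = true then ℓ g (Fin.natAdd m j) else 0))
      (fun g : Fin (m + k + 1) => c + g.val + ∑ j, if v j = true then ww g.val (Fin.natAdd m j) else 0)
      (fun (g : Fin (m + k + 1)) (i : Fin m) => ww g.val (Fin.castAdd k i)) hp5 hζ (fun g i => ww_mem g.val _) hcount'
    refine ⟨u', ?_⟩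
    rw [Bool.eq_false_iff]
    intro hwin
    simp only [ringWinU, decide_eq_true_eq] at hwin
    rw [subcube_filter_eq c y ℓ r hℓr v u'] at hwin
    omega
  -- the projection to the frozen coordinates is onto from the loss set
  have hsurj : Set.SurjOn (fun u : Fin (m + k) → Bool => fun j : Fin k => u (Fin.natAdd m j))
      ↑(univ.filter fun u : Fin (m + k) → Bool => ringWinU c y u = false) ↑(univ : Finset (Fin k → Bool)) := by
    intro v _
    obtain ⟨u', hu'⟩ := hloser v
    refine ⟨Fin.append u' v, ?_, ?_⟩
    · simp [hu']
    · funext j; simp [Fin.append_right]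
  have := card_le_card_of_surjOn _ hsurj
  simpa [card_univ, Fintype.card_fin, Fintype.card_bool, Fintype.card_fun] using this

/-- **Theorem B.**  For `m ≤ n` with `(n+1)·2p·(2p−1)^m < (2p)^m`, every `LinSel p` strategy loses on at least `2^{n−m}` inputs. -/
theorem linSel_loss_lower_bound (ω ζ : K) (hω : IsPrimitiveRoot ω p) (hζ : IsPrimitiveRoot ζ 3)
    (hp5 : 5 ≤ p) (n m : ℕ) (hm : m ≤ n)
    (hcount : (n + 1) * (2 * p) * (2 * p - 1) ^ m < (2 * p) ^ m) (c : ℕ)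
    (y : Fin (n + 1) → (Fin n → Bool) → Bool) (hy : LinSel p y) :
    2 ^ (n - m) ≤ (univ.filter fun u : Fin n → Bool => ringWinU c y u = false).card := by
  obtain ⟨k, rfl⟩ := Nat.exists_eq_add_of_le hm
  rw [Nat.add_sub_cancel_left]
  exact linSel_loss_lower_bound_add ω ζ hω hζ hp5 m k hcount c y hy

end Subcube

end CharTwoKill

/-! ### §11 Instantiation in `𝔽₂(μ_{3p}) = CyclotomicField (3p) (ZMod 2)` -/

section Instantiate

variable (p : ℕ) [Fact p.Prime]

/-- `𝔽₂(μ_{3p})` has characteristic two and contains a primitive `p`-th root and a primitive cube root of unity. -/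
theorem exists_charTwo_roots (hp5 : 5 ≤ p) :
    ∃ (_ : CharP (CyclotomicField (3 * p) (ZMod 2)) 2) (ω ζ : CyclotomicField (3 * p) (ZMod 2)),
      IsPrimitiveRoot ω p ∧ IsPrimitiveRoot ζ 3 := by
  have hodd2 : ¬ 2 ∣ 3 * p := by
    intro h
    rcases (Nat.Prime.dvd_mul Nat.prime_two).mp h with h | h
    · obtain ⟨k, hk⟩ := h; omega
    · rcases (Fact.out : p.Prime).eq_one_or_self_of_dvd 2 h with h' | h' <;> omega
  haveI h3p : NeZero (((3 * p : ℕ) : ZMod 2)) := ⟨by rw [Ne, ZMod.natCast_eq_zero_iff]; exact hodd2⟩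
  haveI : NeZero (3 * p) := ⟨by omega⟩
  have hchar : CharP (CyclotomicField (3 * p) (ZMod 2)) 2 :=
    charP_of_injective_algebraMap (algebraMap (ZMod 2) (CyclotomicField (3 * p) (ZMod 2))).injective 2
  have hμ := IsCyclotomicExtension.zeta_spec (3 * p) (ZMod 2) (CyclotomicField (3 * p) (ZMod 2))
  have hp0 : 0 < 3 * p := by omega
  exact ⟨hchar, _, _, hμ.pow hp0 rfl, hμ.pow hp0 (mul_comm 3 p)⟩

/-- **Theorem A = R5₀ (ROUND-21 §2, typed in `Theorems/WalkFiniteState.lean`) for every prime `p ≥ 5`:**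
no linear-test strategy wins the u-walk game on every input. -/
theorem noPerfectLinSel (hp5 : 5 ≤ p) : NoPerfectLinSel p := by
  obtain ⟨hK, ω, ζ, hω, hζ⟩ := exists_charTwo_roots p hp5
  exact CharTwoKill.noPerfectLinSel_of_roots ω ζ hω hζ hp5

/-- **Theorem B** for every prime `p ≥ 5`: subcube loss bound for linear-test strategies. -/
theorem linSel_loss_ge (hp5 : 5 ≤ p) (n m : ℕ) (hm : m ≤ n)
    (hcount : (n + 1) * (2 * p) * (2 * p - 1) ^ m < (2 * p) ^ m) (c : ℕ)
    (y : Fin (n + 1) → (Fin n → Bool) → Bool) (hy : LinSel p y) :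
    2 ^ (n - m) ≤ (univ.filter fun u : Fin n → Bool => ringWinU c y u = false).card := by
  obtain ⟨hK, ω, ζ, hω, hζ⟩ := exists_charTwo_roots p hp5
  exact CharTwoKill.linSel_loss_lower_bound ω ζ hω hζ hp5 n m hm hcount c y hy

/-- Item form (support item `OddPrimeWalk.NoPerfectLinSelOdd` = stmt-QuantumAdvantage-22578, signature verbatim). -/
theorem noPerfectLinSelOdd : ∀ (p : ℕ) [Fact p.Prime], 5 ≤ p → NoPerfectLinSel p :=
  fun p _ hp => noPerfectLinSel p hp

/-- Item form of Theorem B (candidate support statement `OddPrimeWalk.LinSelSubcubeLossOdd`, ROUND-23 §1: the quantitative R5₀;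
signature verbatim): whenever `m ≤ n` and `(n+1)·2p·(2p−1)^m < (2p)^m`, a linear-test strategy loses on `≥ 2^{n−m}` inputs. -/
theorem linSelSubcubeLossOdd : ∀ (p : ℕ) [Fact p.Prime], 5 ≤ p → ∀ n m : ℕ, m ≤ n →
    (n + 1) * (2 * p) * (2 * p - 1) ^ m < (2 * p) ^ m → ∀ c : ℕ,
    ∀ y : Fin (n + 1) → (Fin n → Bool) → Bool, LinSel p y →
      2 ^ (n - m) ≤ (Finset.univ.filter fun u : Fin n → Bool => ringWinU c y u = false).card :=
  fun p _ hp n m hm hcount c y hy => linSel_loss_ge p hp n m hm hcount c y hy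

end Instantiate

end Coset21

end Summit.QuantumAdvantage.AdviceFreeQNC0
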